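import Summits.QuantumFields.YangMills.Theorems.AllWindowsColdBoxBoxHighLineGhostQuadFormBound
import Summits.QuantumFields.YangMills.Theorems.AllWindowsColdBoxBoxHighLineCubeShellSums

/-!
# `GhostMOpNorm` (U5-BLOCKERS L5 (ii)) — Schur / row-sum bound on the ghost quadratic form: `Σ_j |M_H(i,j)| ≤ C·(1 + log H)`, hence
# `|quadVal M_H a| ≤ C·(1 + log H)·Σ_i a_i²` (planner ym-idea-2 g18 2026-08-29T21:11:36Z «h6b via ‖M_H‖_op ≤ C log H, Schur test on
# ✓`abs_trace_ghostX_edgeMat_mul_le`, row sums Σ_w (1+d)⁻⁴ ≍ log H»; LINE-19 S5 ⟨stmt-QuantumFields-24004⟩/⟨24335⟩, lift L5 of U5 ⟨24336⟩)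

Width seat `ym-line-sfw-p2-w3` (g40).  With `M_H = GhostFP.ghostM H` (✓`…GhostQuadForm`), `M_H(i,j) = −½tr(X_iX_j) − [i=j]·½tr(X_i^Q)`:
the pairing decay ✓`abs_trace_ghostX_edgeMat_mul_le` (`|tr(X_iX_j)| ≤ 2985984·C_G²·Σ_{z,w} endInd_i(z)endInd_j(w)(1+d(z,w))⁻⁴`), the endpoint count
✓`sum_endInd_coord` (`Σ_j endInd_j(w) = 24`), `Σ_z endInd_i(z) ≤ 2` and the logarithmic shell sum ✓`cubeShellSums` (2) on `interiorSites H ⊆ [0,2H]⁴`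
give the ROW SUM bound `sum_abs_ghostM_le`; `ghostM` is symmetric (`ghostM_symm`), so the Schur test gives `abs_quadVal_ghostM_le`.
This is the sharp (`H⁴·log H·t²` instead of `H⁶·(log H)²·t²`) size of the quadratic ghost term on the small field.

Everything proved, no definitions, standard axioms.  HONEST LABEL: a tool for a RECORDED, UNSTAFFED lift (L5) and for the 13K sizes of STEP 2 of the XL stub
S5 of a critic-PASSed DRAFT line; S5, U5, ⟨24004⟩ ⟨24335⟩ ⟨24336⟩ remain OPEN; no crux, rung or summit is proved; **the Yang–Mills mass gap is NOT
proved by this file.**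
-/

set_option autoImplicit false

noncomputable section

open Matrix Finset
open scoped Matrix.Norms.Operator
open Literature.MathematicalPhysics.QuantumFieldTheory.Balaban1983to89.B10Eq18SigmaSU2 (su2Coord)
open Literature.MathematicalPhysics.QuantumLattice (LGConfig ZdEdge)
open Literature.Probability.LatticeModels (Site dirichletMatrix)

namespace Summit.QuantumFields.YangMills.Theorems.AllWindowsColdBoxBoxHighLine

namespace GhostFP

open EdgeChartGaussian (siteDist_comm)

variable {H : ℕ}

/-! ## The logarithmic shell sum over the interior sites -/

/-- `interiorSites H ⊆ [0, 2H]⁴`. -/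
theorem interiorSites_subset_cubeSites (H : ℕ) : interiorSites H ⊆ cubeSites (2 * H) := by
  intro x hx
  simp only [interiorSites, cubeSites, Fintype.mem_piFinset, Finset.mem_Icc] at hx ⊢
  intro k
  obtain ⟨h1, h2⟩ := hx k
  constructor
  · omega
  · push_cast; omega

/-- **Logarithmic shell sum**: `Σ_{w ∈ interiorSites H} (1+d(z,w))⁻⁴ ≤ C·(1 + log H)` uniformly in `z ∈ ℤ⁴`, `H ≥ 1` (from ✓`cubeShellSums` (2) on `[0,2H]⁴`). -/
theorem exists_sum_interior_inv_pow_four_le : ∃ C : ℝ, 0 ≤ C ∧ ∀ H : ℕ, 1 ≤ H → ∀ z : Site 4,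
    ∑ w : ↥(interiorSites H), 1 / (1 + siteDist z (w : Site 4)) ^ 4 ≤ C * (1 + Real.log H) := by
  obtain ⟨C₈, h8⟩ := cubeShellSums
  refine ⟨2 * max C₈ 0, by positivity, fun H hH z => ?_⟩
  have hN : 1 ≤ 2 * H := by omega
  have h := (h8 (2 * H) hN z).2.1
  have hH' : (1 : ℝ) ≤ H := by exact_mod_cast hH
  have hlogH : 0 ≤ Real.log H := Real.log_nonneg hH'
  have hlog2 : Real.log (((2 * H : ℕ)) : ℝ) ≤ 1 + Real.log H := by
    rw [Nat.cast_mul, Nat.cast_two, Real.log_mul (by norm_num) (by positivity)]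
    have : Real.log 2 ≤ 1 := (Real.log_le_sub_one_of_pos (by norm_num)).trans (by norm_num)
    linarith
  have hsub : ∑ w : ↥(interiorSites H), 1 / (1 + siteDist z (w : Site 4)) ^ 4 ≤
      ∑ p ∈ cubeSites (2 * H), 1 / (1 + siteDist p z) ^ 4 := by
    rw [show (∑ w : ↥(interiorSites H), 1 / (1 + siteDist z (w : Site 4)) ^ 4) =
        ∑ w ∈ interiorSites H, 1 / (1 + siteDist w z) ^ 4 from by
      rw [← Finset.sum_coe_sort (interiorSites H)]
      exact Finset.sum_congr rfl fun w _ => by rw [siteDist_comm]]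
    refine Finset.sum_le_sum_of_subset_of_nonneg (interiorSites_subset_cubeSites H) fun p _ _ => ?_
    have := GhostKernel.siteDist_nonneg p z
    positivity
  have hpos : 0 ≤ 1 + Real.log (((2 * H : ℕ)) : ℝ) := by
    have : (1 : ℝ) ≤ ((2 * H : ℕ) : ℝ) := by exact_mod_cast hN
    linarith [Real.log_nonneg this]
  calc ∑ w : ↥(interiorSites H), 1 / (1 + siteDist z (w : Site 4)) ^ 4 ≤ C₈ * (1 + Real.log (((2 * H : ℕ)) : ℝ)) := hsub.trans h
    _ ≤ max C₈ 0 * (1 + Real.log (((2 * H : ℕ)) : ℝ)) := mul_le_mul_of_nonneg_right (le_max_left _ _) hpos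
    _ ≤ max C₈ 0 * (2 * (1 + Real.log H)) := mul_le_mul_of_nonneg_left (by linarith) (le_max_right _ _)
    _ = 2 * max C₈ 0 * (1 + Real.log H) := by ring

/-! ## Row sums of `M_H` -/

/-- `M_H` is symmetric. -/
theorem ghostM_symm (i j : LandauFree H × Fin 3) : ghostM H i j = ghostM H j i := by
  rw [ghostM_apply, ghostM_apply, Matrix.trace_mul_comm]
  by_cases h : i = j
  · subst h; rfl
  · rw [if_neg h, if_neg (Ne.symm h)]

/-- `Σ_j |tr(X_iX_j)| ≤ 2985984·C_G²·48·S₄` where `S₄` bounds the logarithmic shell sum. -/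
theorem sum_abs_trace_pair_le (hG0 : ∀ x z : ↥(interiorSites H), 0 ≤ (dirichletMatrix (interiorSites H))⁻¹ x z) {CG S₄ : ℝ} (hCG : 0 ≤ CG)
    (hGd : ∀ x z : ↥(interiorSites H), (dirichletMatrix (interiorSites H))⁻¹ x z ≤ CG / (1 + siteDist (x : Site 4) (z : Site 4)) ^ 2)
    (hS₄0 : 0 ≤ S₄) (hS₄ : ∀ z : Site 4, ∑ w : ↥(interiorSites H), 1 / (1 + siteDist z (w : Site 4)) ^ 4 ≤ S₄) (i : LandauFree H × Fin 3) :
    ∑ j : LandauFree H × Fin 3, |(ghostX H (basisLinkL H i) * ghostX H (basisLinkL H j)).trace| ≤ 2985984 * CG ^ 2 * (48 * S₄) := by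
  -- each pairing
  have hpair : ∀ j : LandauFree H × Fin 3, |(ghostX H (basisLinkL H i) * ghostX H (basisLinkL H j)).trace| ≤
      2985984 * CG ^ 2 * ∑ z : ↥(interiorSites H), ∑ w : ↥(interiorSites H),
        1 / (1 + siteDist (z : Site 4) (w : Site 4)) ^ 4 * (endInd i.1.1.1 (z : Site 4) * endInd j.1.1.1 (w : Site 4)) := by
    intro j
    have h := abs_trace_ghostX_edgeMat_mul_le hG0 hCG hGd i.1.1.1 j.1.1.1 (su2Coord (Pi.single i.2 (1 : ℝ))) (su2Coord (Pi.single j.2 (1 : ℝ)))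
    have hS0 : 0 ≤ ∑ z : ↥(interiorSites H), ∑ w : ↥(interiorSites H),
        endInd i.1.1.1 (z : Site 4) * endInd j.1.1.1 (w : Site 4) / (1 + siteDist (z : Site 4) (w : Site 4)) ^ 4 :=
      Finset.sum_nonneg fun z _ => Finset.sum_nonneg fun w _ => by
        have := endInd_nonneg i.1.1.1 (z : Site 4); have := endInd_nonneg j.1.1.1 (w : Site 4)
        have := GhostKernel.siteDist_nonneg (z : Site 4) (w : Site 4); positivity
    have hn := mul_le_mul (norm_su2Coord_single_le i.2) (norm_su2Coord_single_le j.2) (norm_nonneg _) (by norm_num)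
    have heq : (∑ z : ↥(interiorSites H), ∑ w : ↥(interiorSites H),
        endInd i.1.1.1 (z : Site 4) * endInd j.1.1.1 (w : Site 4) / (1 + siteDist (z : Site 4) (w : Site 4)) ^ 4) =
        ∑ z : ↥(interiorSites H), ∑ w : ↥(interiorSites H),
          1 / (1 + siteDist (z : Site 4) (w : Site 4)) ^ 4 * (endInd i.1.1.1 (z : Site 4) * endInd j.1.1.1 (w : Site 4)) :=
      Finset.sum_congr rfl fun z _ => Finset.sum_congr rfl fun w _ => by ring
    calc |(ghostX H (basisLinkL H i) * ghostX H (basisLinkL H j)).trace|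
        ≤ 331776 * ‖su2Coord (Pi.single i.2 (1 : ℝ))‖ * ‖su2Coord (Pi.single j.2 (1 : ℝ))‖ * CG ^ 2 * _ := h
      _ = 331776 * (‖su2Coord (Pi.single i.2 (1 : ℝ))‖ * ‖su2Coord (Pi.single j.2 (1 : ℝ))‖) * (CG ^ 2 * _) := by ring
      _ ≤ 331776 * (3 * 3) * (CG ^ 2 * _) :=
          mul_le_mul_of_nonneg_right (mul_le_mul_of_nonneg_left hn (by norm_num)) (mul_nonneg (sq_nonneg _) hS0)
      _ = 2985984 * CG ^ 2 * _ := by rw [heq]; ring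
  refine (Finset.sum_le_sum fun j _ => hpair j).trans ?_
  rw [← Finset.mul_sum, sum_exchange3]
  refine mul_le_mul_of_nonneg_left ?_ (by positivity)
  -- `Σ_z e_i(z) · Σ_w (1+d)⁻⁴ · Σ_j e_j(w) = 24 Σ_z e_i(z) Σ_w (1+d)⁻⁴ ≤ 24 · 2 · S₄`
  have hin : ∀ z : ↥(interiorSites H), ∑ w : ↥(interiorSites H), 1 / (1 + siteDist (z : Site 4) (w : Site 4)) ^ 4 *
      ∑ j : LandauFree H × Fin 3, endInd j.1.1.1 (w : Site 4) ≤ 24 * S₄ := by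
    intro z
    rw [show (∑ w : ↥(interiorSites H), 1 / (1 + siteDist (z : Site 4) (w : Site 4)) ^ 4 *
        ∑ j : LandauFree H × Fin 3, endInd j.1.1.1 (w : Site 4)) =
        24 * ∑ w : ↥(interiorSites H), 1 / (1 + siteDist (z : Site 4) (w : Site 4)) ^ 4 from by
      rw [Finset.mul_sum]; exact Finset.sum_congr rfl fun w _ => by rw [sum_endInd_coord]; ring]
    exact mul_le_mul_of_nonneg_left (hS₄ (z : Site 4)) (by norm_num)
  calc ∑ z : ↥(interiorSites H), endInd i.1.1.1 (z : Site 4) * ∑ w : ↥(interiorSites H),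
        1 / (1 + siteDist (z : Site 4) (w : Site 4)) ^ 4 * ∑ j : LandauFree H × Fin 3, endInd j.1.1.1 (w : Site 4)
      ≤ ∑ z : ↥(interiorSites H), endInd i.1.1.1 (z : Site 4) * (24 * S₄) :=
        Finset.sum_le_sum fun z _ => mul_le_mul_of_nonneg_left (hin z) (endInd_nonneg _ _)
    _ = (∑ z : ↥(interiorSites H), endInd i.1.1.1 (z : Site 4)) * (24 * S₄) := by rw [Finset.sum_mul]
    _ ≤ 2 * (24 * S₄) := mul_le_mul_of_nonneg_right (sum_endInd_le _) (by positivity)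
    _ = 48 * S₄ := by ring

/-- **Row sums of `M_H`** (explicit constants): `Σ_j |M_H(i,j)| ≤ 2985984·C_G²·24·S₄ + 144·C_G`. -/
theorem sum_abs_ghostM_le_of (hG0 : ∀ x z : ↥(interiorSites H), 0 ≤ (dirichletMatrix (interiorSites H))⁻¹ x z) {CG S₄ : ℝ} (hCG : 0 ≤ CG)
    (hGd : ∀ x z : ↥(interiorSites H), (dirichletMatrix (interiorSites H))⁻¹ x z ≤ CG / (1 + siteDist (x : Site 4) (z : Site 4)) ^ 2)
    (hS₄0 : 0 ≤ S₄) (hS₄ : ∀ z : Site 4, ∑ w : ↥(interiorSites H), 1 / (1 + siteDist z (w : Site 4)) ^ 4 ≤ S₄) (i : LandauFree H × Fin 3) :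
    ∑ j : LandauFree H × Fin 3, |ghostM H i j| ≤ 2985984 * CG ^ 2 * (24 * S₄) + 144 * CG := by
  have hGC : ∀ x z : ↥(interiorSites H), (dirichletMatrix (interiorSites H))⁻¹ x z ≤ CG := by
    intro x z
    refine (hGd x z).trans (div_le_self hCG ?_)
    have hd := GhostKernel.siteDist_nonneg (x : Site 4) (z : Site 4)
    exact one_le_pow₀ (by linarith)
  have hQ : |(ghostX H (basisLinkQ H i.1)).trace| ≤ 288 * CG := by
    have h := abs_trace_ghostX_edgeMat_le hG0 hCG hGC i.1.1.1 (1 : Matrix (Fin 2) (Fin 2) ℂ)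
    rw [norm_one, mul_one] at h
    exact h
  have hsplit : ∀ j : LandauFree H × Fin 3, |ghostM H i j| ≤
      1 / 2 * |(ghostX H (basisLinkL H i) * ghostX H (basisLinkL H j)).trace| + (if i = j then 144 * CG else 0) := by
    intro j
    rw [ghostM_apply]
    by_cases hij : i = j
    · rw [if_pos hij, if_pos hij]
      calc _ ≤ |-(1 / 2) * (ghostX H (basisLinkL H i) * ghostX H (basisLinkL H j)).trace| + |1 / 2 * (ghostX H (basisLinkQ H i.1)).trace| :=
            abs_sub _ _
        _ ≤ _ := by
            rw [abs_mul, abs_mul, abs_neg, abs_of_pos (by norm_num : (0 : ℝ) < 1 / 2)]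
            linarith
    · rw [if_neg hij, if_neg hij, sub_zero, abs_mul, abs_neg, abs_of_pos (by norm_num : (0 : ℝ) < 1 / 2), add_zero]
  calc ∑ j, |ghostM H i j| ≤ ∑ j : LandauFree H × Fin 3,
        (1 / 2 * |(ghostX H (basisLinkL H i) * ghostX H (basisLinkL H j)).trace| + (if i = j then 144 * CG else 0)) :=
        Finset.sum_le_sum fun j _ => hsplit j
    _ = 1 / 2 * ∑ j : LandauFree H × Fin 3, |(ghostX H (basisLinkL H i) * ghostX H (basisLinkL H j)).trace| + 144 * CG := by
        rw [Finset.sum_add_distrib, Finset.mul_sum, Finset.sum_ite_eq Finset.univ i, if_pos (Finset.mem_univ _)]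
    _ ≤ 1 / 2 * (2985984 * CG ^ 2 * (48 * S₄)) + 144 * CG := by
        have := sum_abs_trace_pair_le hG0 hCG hGd hS₄0 hS₄ i
        linarith
    _ = 2985984 * CG ^ 2 * (24 * S₄) + 144 * CG := by ring

/-- ★ **`GhostMOpNorm` (row-sum / Schur form)**: `∃ C, ∀ H ≥ 1, ∀ i, Σ_j |M_H(i,j)| ≤ C·(1 + log H)`. -/
theorem sum_abs_ghostM_le : ∃ C : ℝ, 0 ≤ C ∧ ∀ H : ℕ, 1 ≤ H → ∀ i : LandauFree H × Fin 3,
    ∑ j : LandauFree H × Fin 3, |ghostM H i j| ≤ C * (1 + Real.log H) := by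
  obtain ⟨CG₀, hK⟩ := ghostKernelDecay
  obtain ⟨C₄, hC₄0, h4⟩ := exists_sum_interior_inv_pow_four_le
  set CG : ℝ := max CG₀ 0 with hCGdef
  have hCG : 0 ≤ CG := le_max_right _ _
  refine ⟨2985984 * CG ^ 2 * (24 * C₄) + 144 * CG, by positivity, fun H hH i => ?_⟩
  have hH' : (1 : ℝ) ≤ H := by exact_mod_cast hH
  have hL : 1 ≤ 1 + Real.log H := by linarith [Real.log_nonneg hH']
  have hG0 : ∀ x z : ↥(interiorSites H), 0 ≤ (dirichletMatrix (interiorSites H))⁻¹ x z := fun x z => (hK H hH x z).1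
  have hGd : ∀ x z : ↥(interiorSites H), (dirichletMatrix (interiorSites H))⁻¹ x z ≤ CG / (1 + siteDist (x : Site 4) (z : Site 4)) ^ 2 := by
    intro x z
    refine (hK H hH x z).2.trans ?_
    have := GhostKernel.siteDist_nonneg (x : Site 4) (z : Site 4)
    exact div_le_div_of_nonneg_right (le_max_left _ _) (by positivity)
  have h := sum_abs_ghostM_le_of hG0 hCG hGd (S₄ := C₄ * (1 + Real.log H)) (by positivity) (h4 H hH) i
  refine h.trans ?_
  have hC : 0 ≤ 144 * CG := by positivity
  have h1 := mul_le_mul_of_nonneg_left hL hC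
  linarith

/-! ## The Schur test -/

/-- Schur test for a symmetric matrix with row sums `≤ R`: `|x · M x| ≤ R · Σ x_i²`. -/
theorem abs_dotProduct_mulVec_le_of_symm {ι : Type*} [Fintype ι] (M : Matrix ι ι ℝ) (hM : ∀ i j, M i j = M j i) {R : ℝ}
    (hR : ∀ i, ∑ j, |M i j| ≤ R) (x : ι → ℝ) : |x ⬝ᵥ (M *ᵥ x)| ≤ R * ∑ i, x i ^ 2 := by
  have hx2 : ∀ i, 0 ≤ x i ^ 2 := fun i => sq_nonneg _
  -- `|Σ_i x_i Σ_j M_ij x_j| ≤ Σ_i Σ_j |M_ij| (x_i² + x_j²)/2`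
  have h1 : |x ⬝ᵥ (M *ᵥ x)| ≤ ∑ i, ∑ j, |M i j| * ((x i ^ 2 + x j ^ 2) / 2) := by
    simp only [dotProduct, Matrix.mulVec]
    refine (Finset.abs_sum_le_sum_abs _ _).trans (Finset.sum_le_sum fun i _ => ?_)
    rw [Finset.mul_sum]
    refine (Finset.abs_sum_le_sum_abs _ _).trans (Finset.sum_le_sum fun j _ => ?_)
    rw [abs_mul, abs_mul]
    have h2 : |x i| * |x j| ≤ (x i ^ 2 + x j ^ 2) / 2 := by
      have := sq_abs (x i); have := sq_abs (x j); nlinarith [sq_nonneg (|x i| - |x j|)]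
    calc |x i| * (|M i j| * |x j|) = |M i j| * (|x i| * |x j|) := by ring
      _ ≤ |M i j| * ((x i ^ 2 + x j ^ 2) / 2) := mul_le_mul_of_nonneg_left h2 (abs_nonneg _)
  -- the two halves are equal by symmetry
  have hhalf : ∑ i, ∑ j, |M i j| * ((x i ^ 2 + x j ^ 2) / 2) = ∑ i, x i ^ 2 * ∑ j, |M i j| := by
    have hA : ∑ i, ∑ j, |M i j| * (x i ^ 2 / 2) = ∑ i, x i ^ 2 / 2 * ∑ j, |M i j| := by
      refine Finset.sum_congr rfl fun i _ => ?_
      rw [Finset.mul_sum]; exact Finset.sum_congr rfl fun j _ => by ring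
    have hB : ∑ i, ∑ j, |M i j| * (x j ^ 2 / 2) = ∑ i, x i ^ 2 / 2 * ∑ j, |M i j| := by
      rw [Finset.sum_comm]
      refine Finset.sum_congr rfl fun j _ => ?_
      rw [Finset.mul_sum]; exact Finset.sum_congr rfl fun i _ => by rw [hM i j]; ring
    calc ∑ i, ∑ j, |M i j| * ((x i ^ 2 + x j ^ 2) / 2) = ∑ i, ∑ j, (|M i j| * (x i ^ 2 / 2) + |M i j| * (x j ^ 2 / 2)) :=
          Finset.sum_congr rfl fun i _ => Finset.sum_congr rfl fun j _ => by ring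
      _ = ∑ i, ∑ j, |M i j| * (x i ^ 2 / 2) + ∑ i, ∑ j, |M i j| * (x j ^ 2 / 2) := by
          rw [← Finset.sum_add_distrib]; exact Finset.sum_congr rfl fun i _ => Finset.sum_add_distrib
      _ = ∑ i, x i ^ 2 * ∑ j, |M i j| := by rw [hA, hB, ← Finset.sum_add_distrib]; exact Finset.sum_congr rfl fun i _ => by ring
  rw [hhalf] at h1
  refine h1.trans ?_
  rw [Finset.mul_sum]
  exact Finset.sum_le_sum fun i _ => by rw [mul_comm]; exact mul_le_mul_of_nonneg_right (hR i) (hx2 i)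

/-- ★★ **Sharp size of the quadratic ghost term**: `∃ C, ∀ H ≥ 1, ∀ a, |quadVal M_H a| ≤ C·(1 + log H)·Σ_i a_i²`. -/
theorem abs_quadVal_ghostM_le : ∃ C : ℝ, 0 ≤ C ∧ ∀ H : ℕ, 1 ≤ H → ∀ a : LandauFree H → E3,
    |quadVal (ghostM H) a| ≤ C * (1 + Real.log H) * ∑ i : LandauFree H × Fin 3, (a i.1 i.2) ^ 2 := by
  obtain ⟨C, hC0, hrow⟩ := sum_abs_ghostM_le
  refine ⟨C, hC0, fun H hH a => ?_⟩
  exact abs_dotProduct_mulVec_le_of_symm (ghostM H) ghostM_symm (hrow H hH) (flat a)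

end GhostFP

end Summit.QuantumFields.YangMills.Theorems.AllWindowsColdBoxBoxHighLine

end
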